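import Summits.QuantumFields.BalabanUV.Beta.D1BFx.NeedleDipProjPointwise
import Summits.QuantumFields.BalabanUV.Beta.D1BFx.NeedleDipDipRow

/-!
# `BalabanUV.Beta.D1BFx.NeedleDipProjRow` — road «BF-x» for binder row D1, slot (K), END row `hGrp gN`, «GN-33 ∕ PK∕KP» PART 2: THE TWO
# `dipPiece ⊗ projPiece` CELLS OF THE GLUON NEEDLE ROW T₃ WITH THEIR WEIGHT `cK(n)` (`|cK n| ≤ cgh·n²`) ARE n-UNIFORM —
# `|cK n·cellSum n a (dipPiece n a) (projPiece n a) μ ν| ≤ Cdp` and `|cK n·cellSum n a (projPiece n a) (dipPiece n a) μ ν| ≤ Cpd` for every `n ≥ 2`,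
# modulo [B5, Prop. 1.2] ∧ [B5, (1.126)–(1.127)] BY NAME — UNCONDITIONAL otherwise (no pairing letter displayed: the `(δρ, δρ′)` type does not occur)

HONEST DEPENDENCY (cell records, verbatim): «continuum YM on T⁴ ⇐ BetaPertH ∧ nine spine estimates (0/9 proved); BetaPertH ⇐ (D1) ∧ (D4) ∧
CAP+tail; G-an2-4 gates asym, D1 and NE2/3/4.»  HONEST FRAMING (cell contract, verbatim): «discharging `BetaPertH` makes Bałaban's UV stability
UNCONDITIONAL — a real constructive-QFT result; it is NOT the continuum limit and NOT the Clay problem.»  THIS MODULE DISCHARGES NOTHING of the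
wall: [folklore] lattice bookkeeping BY NAME over PART 1 (`NeedleDipProjPointwise.abs_dipProj_word_le`), leaf-04-g9's letter pack `NeedleDipDipLetters`
(`exists_legLetters`, `exists_functionLetters`), pairing types `NeedleDipPairings(Coul)` and kit (`NeedleDipDipRow.abs_fullSum_threeShapes_le`,
`LatticeHLSDamped.abs_applyK_le_of_damped_flat ∕ _profiles`, `PairingByParts.abs_applyK_grad_le_of_damped_profiles`), the projector symmetry
`RProjector.Pgt_symm`, leaf-03's `FineHessianSectors.biBubbleTable_transpose` and the owner's `NeedleProjProjRow.sum_resSite_avg_le` ∕ `GluonNeedleGlue.cellSum`.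
No `def`, no `def … : Prop`, nothing cited, 0 sorry; the printed statements enter as the HYPOTHESES `h12`∕`h126`.  Root-level binders hW ∕ hR-sockets ∕
hSX-socket ∕ D1Tel ∕ D1Rep — 0 discharged; (K) NOT closed; NOT D1, NOT `BetaPertH`, NOT continuum, NOT Clay.

ABSOLUTE RULE (cell charter, verbatim): «No internally-minted statement may enter as a cited fact. Every hypothesis is either kernel-proved in
this package or a verbatim quotation of a PUBLISHED theorem with page reference. The manuscript(s) under audit are NOT citable for their own
disputed steps — they are the thing under adjudication; programme-internal (2001/route/tribunal) claims are never citable.»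

WHY (owner d1-p2 claim table «GN-CELLS» = `HOME/b2b-balaban-beta-d1-p2/GLUON-NEEDLE-ROWS.md` v0.3, cells PK∕KP; owner d1-p2-g11 2026-08-21T12:33Z
«PK∕KP: first refusal stands for leaf-04-g10»; target hypotheses `hdp`∕`hpd` of `GluonNeedleGlue.h₃_of_cells`; an3-g59 §3′ (4) «PK c·n⁰»).
THE COUNT.  The letters: point values `(Ga∇p_u) ≍ n⁻³·e`, `(Ga∇δp_u) ≍ n⁻⁴·e`, `(Ga∇ρ_u) ≍ n⁻²·e∕nrm`, `(Ga∇δρ_u) ≍ n⁻²·e∕nrm²` (damped at the dipole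
bond, site rate `ε₀∕2n`); pairing sups against the projector column∕row gradients (both are `∇p_{v′}` by `Pgt_symm`, flat `n⁻⁵`): `n⁻⁴` (flat∕Coulomb
partners) or `n⁻⁵` (dipole ∕ second-difference partners).  Hence the word is `T₀n⁻⁸·e + T₁n⁻⁷·e∕nrm + T₂n⁻⁶·e∕nrm²` (§1); the (1.22) sums of
`|w|²·{e, e∕nrm, e∕nrm²}` are `n⁶, n⁵, n⁴`; the base average is convex; the weight is `|cK n| ≤ cgh·n²`: n⁰, with NO Coulomb × Coulomb type and
therefore no displayed pairing letter (contrast «KK»'s `h𝔅₂₂`).  The mirror cell `proj ⊗ dip` is the same word read at `(ν, μ, b, b+w)` by the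
cyclicity of the trace (`biBubbleTable_transpose`); the pointwise bound is even in `u − v`.

CONTENT (`a > 0`).
* §1 [folklore] **`exists_dipProj_word_threeShapes`** — `∃ η T₀ T₁ T₂`, for all `n ≥ 1` and all bond pairs:
  `|bubble (Ga n a) (dipPiece n a κ u) (projPiece n a κ′ v)| ≤ T₀∕n⁸·e + T₁∕n⁷·e∕nrm(u−v) + T₂∕n⁶·e∕nrm(u−v)²`, `e = e^{−(η∕n)‖u−v‖∞}` (one
  `set_option maxHeartbeats 800000 in`: twelve letter instantiations + the n-power bookkeeping in ONE declaration, arithmetic only).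
* §2 [folklore] `abs_cellSum_le_of_threeShapes` — a cell whose table is pointwise in the three shapes has `|cellSum| ≤ Z₀·S₀·n⁶ + Z₁·S₁·n⁵ + Z₂·S₂·n⁴`.
* §3 [folklore] **`exists_dipProj_row_le`** (`hdp`) and **`exists_projDip_row_le`** (`hpd`) — `∃ C ≥ 0, ∀ n ≥ 2, |cK n·cellSum …| ≤ C`.
Unit `b2b-balaban-beta-d1-formalise-leaf-04` (gen 10); `LEAVES-BFx.md` row (N) «GN-33∕PK∕KP» PART 2.
-/

noncomputable section

namespace Summit.QuantumFields.BalabanUV.Beta.D1BFx.NeedleDipProjRow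

open Finset
open scoped BigOperators
open Literature.MathematicalPhysics.QuantumFieldTheory.Balaban1983to89
open Literature.MathematicalPhysics.QuantumFieldTheory.Balaban1983to89.Beta
open ExpKernelCalculus (Site MKer bubble BiLoc)
open DyadicShell (Pt toReal toReal_apply)
open WindowIdentification (fullSum)
open DressedMomentNormalisation (resSite)
open AffineAveraging (unitVec)
open VectorTailsLoc (fam kfam)
open PoissonInterior (nrm nrm_pos one_le_nrm nrm_neg supNorm supNorm_neg)
open Summit.QuantumFields.BalabanUV.Beta.TameKernelCalculus (Spr)
open Summit.QuantumFields.BalabanUV.Beta.D1BFx.ReducedKernel (StencilR)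
open Summit.QuantumFields.BalabanUV.Beta.D1BFx.PackedKernelSplit (bubble_eq_biBubble)
open Summit.QuantumFields.BalabanUV.Beta.D1BFx.FineHessianSectors (biBubbleTable biBubbleTable_apply biBubbleTable_transpose)
open Summit.QuantumFields.BalabanUV.Beta.D1BFx.RProjector (Pgt Pgt_symm)
open Summit.QuantumFields.BalabanUV.Beta.D1BFx.GhostLeg (Ggh)
open Summit.QuantumFields.BalabanUV.Beta.D1BFx.RProjectorJet (RG)
open Summit.QuantumFields.BalabanUV.Beta.D1BFx.GluonLeg (Ga)
open Summit.QuantumFields.BalabanUV.Beta.D1BFx.GluonLegTails (spr_Ga_of_prop12)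
open Summit.QuantumFields.BalabanUV.Beta.D1BFx.FrozenLegTails (nOf MOf hn1)
open Summit.QuantumFields.BalabanUV.Beta.D1BFx.GluonNeedleSplit (dipPiece projPiece)
open Summit.QuantumFields.BalabanUV.Beta.D1BFx.GluonNeedleGlue (cellSum cellSum_def exists_biLoc_projPiece exists_biLoc_dipPiece)
open Summit.QuantumFields.BalabanUV.Beta.D1BFx.RankOneBubble (applyK pairing pairing_comm)
open Summit.QuantumFields.BalabanUV.Beta.D1BFx.RankOneBubbleJets (grad colGrad rowGrad colGrad_eq_grad rowGrad_eq_grad)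
open Summit.QuantumFields.BalabanUV.Beta.D1BFx.LatticeHLSDamped (abs_applyK_le_of_damped_profiles abs_applyK_le_of_damped_flat)
open Summit.QuantumFields.BalabanUV.Beta.D1BFx.PairingByParts (abs_applyK_grad_le_of_damped_profiles)
open Summit.QuantumFields.BalabanUV.Beta.D1BFx.NeedleDipPairings (kitConst_le abs_pairing_flat_flat_le abs_pairing_flat_coul_le abs_pairing_flat_dip_le
  abs_pairing_coul_flat_le)
open Summit.QuantumFields.BalabanUV.Beta.D1BFx.NeedleDipPairingsCoul (abs_pairing_dip_flat_le)
open Summit.QuantumFields.BalabanUV.Beta.D1BFx.NeedleDipDipLetters (exists_legLetters exists_functionLetters exp_rate_mono)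
open Summit.QuantumFields.BalabanUV.Beta.D1BFx.NeedleDipProjPointwise (abs_dipProj_word_le)
open Summit.QuantumFields.BalabanUV.Beta.D1BFx.NeedleProjProjRow (sum_resSite_avg_le)
open Summit.QuantumFields.BalabanUV.Beta.D1BFx.NeedleDipDipRow (abs_fullSum_threeShapes_le)

/-! ## §1 The word in the three shapes with its n-scaling -/

set_option maxHeartbeats 800000 in
/-- [folklore] **THE `dip ⊗ proj` WORD IN THE THREE SHAPES**, modulo [B5, Prop. 1.2] ∧ [B5, (1.126)–(1.127)] BY NAME: `∃ η > 0`, `T₀, T₁, T₂ ≥ 0`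
(n-free) with, for every `n ≥ 1` and all bond pairs,
`|bubble (Ga n a) (dipPiece n a κ u) (projPiece n a κ′ v)| ≤ T₀∕n⁸·e^{−(η∕n)‖u−v‖} + T₁∕n⁷·e^{…}∕nrm(u−v) + T₂∕n⁶·e^{…}∕nrm(u−v)²` — PART 1's pointwise
bound with the four point-value letters (`abs_applyK_le_of_damped_flat` ×2, `abs_applyK_le_of_damped_profiles`, `abs_applyK_grad_le_of_damped_profiles`)
and the eight pairing sups (`abs_pairing_flat_flat_le` ×4, `flat_dip`, `flat_coul`, `dip_flat`, `coul_flat`, decay factors discarded) instantiated from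
`exists_legLetters` ∕ `exists_functionLetters` at the common rate `ε₀ = min ε₁ ε₂`, the projector column read as a row by `Pgt_symm`. -/
theorem exists_dipProj_word_threeShapes {a : ℝ} (ha : 0 < a) (h12 : B5.Prop12Printed (fam nOf hn1 MOf a ha))
    (h126 : B5.Kernel126_127Printed (kfam nOf MOf)) :
    ∃ η T₀ T₁ T₂ : ℝ, 0 < η ∧ 0 ≤ T₀ ∧ 0 ≤ T₁ ∧ 0 ≤ T₂ ∧ ∀ (n : ℕ) [NeZero n] (κ κ' : Fin 4) (u v : Site 4),
      |bubble (Ga n a) (dipPiece n a κ u) (projPiece n a κ' v)| ≤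
        T₀ / (n : ℝ) ^ 8 * Real.exp (-(η / n) * supNorm (u - v))
          + T₁ / (n : ℝ) ^ 7 * Real.exp (-(η / n) * supNorm (u - v)) / nrm (u - v)
          + T₂ / (n : ℝ) ^ 6 * Real.exp (-(η / n) * supNorm (u - v)) / nrm (u - v) ^ 2 := by
  obtain ⟨ε₁, kA, kA₁, hε₁, hε₁1, hkA, hkA₁, hleg⟩ := exists_legLetters a ha h12 h126
  obtain ⟨ε₂, cF, kR, hε₂, hε₂1, hcF, hkR, hfun⟩ := exists_functionLetters a ha
  obtain ⟨ε₀, hε₀_def⟩ : ∃ ε₀ : ℝ, ε₀ = min ε₁ ε₂ := ⟨_, rfl⟩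
  have hε₀ : 0 < ε₀ := by rw [hε₀_def]; exact lt_min hε₁ hε₂
  have hε₀1 : ε₀ ≤ 1 := by rw [hε₀_def]; exact (min_le_left _ _).trans hε₁1
  have hε₀h : 0 < ε₀ / 2 := half_pos hε₀
  have hε₀h1 : ε₀ / 2 ≤ 1 := by linarith
  -- the n-free kit constants
  obtain ⟨κ₀, hκ₀⟩ : ∃ κ₀ : ℝ, κ₀ = (217 * ((Nat.factorial (3 - 0) : ℝ) * (4 / (ε₀ / 2)) ^ (3 - 0) * (1 + 4 / (ε₀ / 2)))) := ⟨_, rfl⟩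
  obtain ⟨κ₁, hκ₁⟩ : ∃ κ₁ : ℝ, κ₁ = (217 * ((Nat.factorial (3 - 1) : ℝ) * (4 / ε₀) ^ (3 - 1) * (1 + 4 / ε₀))) := ⟨_, rfl⟩
  obtain ⟨κ₂, hκ₂⟩ : ∃ κ₂ : ℝ, κ₂ = (217 * ((Nat.factorial (3 - 2) : ℝ) * (4 / ε₀) ^ (3 - 2) * (1 + 4 / ε₀))) := ⟨_, rfl⟩
  obtain ⟨κ₃, hκ₃⟩ : ∃ κ₃ : ℝ, κ₃ = (217 * ((Nat.factorial (3 - 3) : ℝ) * (4 / ε₀) ^ (3 - 3) * (1 + 4 / ε₀))) := ⟨_, rfl⟩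
  obtain ⟨κ₃', hκ₃'⟩ : ∃ κ₃' : ℝ, κ₃' = (217 * ((Nat.factorial (3 - 3) : ℝ) * (4 / (ε₀ / 2)) ^ (3 - 3) * (1 + 4 / (ε₀ / 2)))) := ⟨_, rfl⟩
  have hκ₀0 : 0 ≤ κ₀ := by rw [hκ₀]; positivity
  have hκ₁0 : 0 ≤ κ₁ := by rw [hκ₁]; positivity
  have hκ₂0 : 0 ≤ κ₂ := by rw [hκ₂]; positivity
  have hκ₃0 : 0 ≤ κ₃ := by rw [hκ₃]; positivity
  have hκ₃'0 : 0 ≤ κ₃' := by rw [hκ₃']; positivity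
  -- the n-free constants of the three shapes
  obtain ⟨T₀, hT₀⟩ : ∃ T₀ : ℝ, T₀ = (4 * kA * cF * κ₂) * (4 * (4 * kA₁ * kR * 373248) * cF * κ₂) + (4 * kA * cF * κ₂) * (4 * (4 * kA * kR * 373248) * cF * κ₁)
      + (4 * kR * (4 * kA₁ * cF * κ₃) * κ₃') * (4 * kA * cF * κ₂) + (4 * kR * (4 * kA * cF * κ₂) * κ₃') * (4 * kA * cF * κ₂) := ⟨_, rfl⟩
  obtain ⟨T₁, hT₁⟩ : ∃ T₁ : ℝ, T₁ = (4 * cF * (4 * kA * cF * κ₂) * κ₀) * (4 * kA * kR * 373248) + (4 * kA * kR * 373248) * (4 * cF * (4 * kA * cF * κ₂) * κ₀) :=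
    ⟨_, rfl⟩
  obtain ⟨T₂, hT₂⟩ : ∃ T₂ : ℝ, T₂ = (4 * cF * (4 * kA * cF * κ₂) * κ₀) * (4 * kA₁ * kR * 373248) + (4 * kA₁ * kR * 373248) * (4 * cF * (4 * kA * cF * κ₂) * κ₀) :=
    ⟨_, rfl⟩
  refine ⟨ε₀ / 2, T₀, T₁, T₂, hε₀h, by rw [hT₀]; positivity, by rw [hT₁]; positivity, by rw [hT₂]; positivity, fun n _ κ κ' u v => ?_⟩
  have hn1 : 1 ≤ n := NeZero.one_le
  have hn : (0 : ℝ) < n := by exact_mod_cast Nat.pos_of_ne_zero (NeZero.ne n)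
  have hn0 : (n : ℝ) ≠ 0 := hn.ne'
  have hA : Spr (Ga n a) := spr_Ga_of_prop12 (a := a) (ha := ha) h12 h126 n
  have hεn : 0 < ε₀ / n := div_pos hε₀ hn
  -- the letters at rate ε₀/n
  obtain ⟨hA0, hA0r, hA1r, hA1l⟩ := hleg ε₀ hε₀ (by rw [hε₀_def]; exact min_le_left _ _) n
  have hfn := hfun ε₀ hε₀ (by rw [hε₀_def]; exact min_le_right _ _) n
  have hkA' : 0 ≤ 4 * Real.exp 1 * kA := by positivity
  have hcF5 : 0 ≤ cF / (n : ℝ) ^ 5 := by positivity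
  have hcF6 : 0 ≤ cF / (n : ℝ) ^ 6 := by positivity
  have hkR2 : 0 ≤ kR / (n : ℝ) ^ 2 := by positivity
  -- the kit constants at this n
  have hK0 : (1 + 2 * ((4 : ℕ) : ℝ) * 3 ^ (4 - 1) * ((Nat.factorial (4 - 1 - 0) : ℝ) * (2 / ((ε₀ / n / 2) / 2)) ^ (4 - 1 - 0) * (1 + 2 / ((ε₀ / n / 2) / 2))))
      ≤ κ₀ * (n : ℝ) ^ 4 := by
    have h := kitConst_le (a := 0) (by norm_num) hε₀h hε₀h1 hn1
    have e : ε₀ / (n : ℝ) / 2 = ε₀ / 2 / n := by ring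
    rw [e]; refine h.trans (le_of_eq ?_); rw [hκ₀]
  have hK1 : (1 + 2 * ((4 : ℕ) : ℝ) * 3 ^ (4 - 1) * ((Nat.factorial (4 - 1 - 1) : ℝ) * (2 / ((ε₀ / n) / 2)) ^ (4 - 1 - 1) * (1 + 2 / ((ε₀ / n) / 2))))
      ≤ κ₁ * (n : ℝ) ^ 3 := by
    refine (kitConst_le (a := 1) (by norm_num) hε₀ hε₀1 hn1).trans (le_of_eq ?_); rw [hκ₁]
  have hK2 : (1 + 2 * ((4 : ℕ) : ℝ) * 3 ^ (4 - 1) * ((Nat.factorial (4 - 1 - 2) : ℝ) * (2 / ((ε₀ / n) / 2)) ^ (4 - 1 - 2) * (1 + 2 / ((ε₀ / n) / 2))))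
      ≤ κ₂ * (n : ℝ) ^ 2 := by
    refine (kitConst_le (a := 2) (by norm_num) hε₀ hε₀1 hn1).trans (le_of_eq ?_); rw [hκ₂]
  have hK3 : (1 + 2 * ((4 : ℕ) : ℝ) * 3 ^ (4 - 1) * ((Nat.factorial (4 - 1 - 3) : ℝ) * (2 / ((ε₀ / n) / 2)) ^ (4 - 1 - 3) * (1 + 2 / ((ε₀ / n) / 2))))
      ≤ κ₃ * (n : ℝ) ^ 1 := by
    refine (kitConst_le (a := 3) (by norm_num) hε₀ hε₀1 hn1).trans (le_of_eq ?_); rw [hκ₃]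
  have hK3' : (1 + 2 * ((4 : ℕ) : ℝ) * 3 ^ (4 - 1) * ((Nat.factorial (4 - 1 - 3) : ℝ) * (2 / ((ε₀ / n / 2) / 2)) ^ (4 - 1 - 3) * (1 + 2 / ((ε₀ / n / 2) / 2))))
      ≤ κ₃' * (n : ℝ) ^ 1 := by
    have h := kitConst_le (a := 3) (by norm_num) hε₀h hε₀h1 hn1
    have e : ε₀ / (n : ℝ) / 2 = ε₀ / 2 / n := by ring
    rw [e]; refine h.trans (le_of_eq ?_); rw [hκ₃']
  -- decay factors: discarded in the pairings, weakened to the rate ε₀/(2n) in the point values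
  have lE : ∀ (r : ℝ) (z : Site 4), 0 ≤ r → Real.exp (-r * supNorm z) ≤ 1 := fun r z hr => by
    rw [Real.exp_le_one_iff, neg_mul]; exact neg_nonpos.mpr (mul_nonneg hr (Nat.cast_nonneg _))
  have lrate : ∀ z : Site 4, Real.exp (-(ε₀ / n) * supNorm z) ≤ Real.exp (-(ε₀ / 2 / n) * supNorm z) := fun z =>
    exp_rate_mono n (by linarith) _
  have erate : ∀ s : ℝ, -(ε₀ / (n : ℝ) / 2) * s = -(ε₀ / 2 / n) * s := fun s => by ring
  -- the projector column is a projector row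
  have hcol : ∀ q : Site 4, colGrad (Pgt n a) q = grad (fun z => Pgt n a q z () ()) := fun q => by
    rw [colGrad_eq_grad]; congr 1; funext x; exact Pgt_symm n ha x q () ()
  -- names for the n-dependent letter values
  obtain ⟨Pp, hPp⟩ : ∃ Pp : ℝ, Pp = 4 * kA * (cF / (n : ℝ) ^ 5) * (κ₂ * (n : ℝ) ^ 2) := ⟨_, rfl⟩
  obtain ⟨Pdp, hPdp⟩ : ∃ Pdp : ℝ, Pdp = 4 * kA * (cF / (n : ℝ) ^ 6) * (κ₂ * (n : ℝ) ^ 2) := ⟨_, rfl⟩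
  obtain ⟨Pr, hPr⟩ : ∃ Pr : ℝ, Pr = 4 * kA * (kR / (n : ℝ) ^ 2) * 373248 := ⟨_, rfl⟩
  obtain ⟨Pdr, hPdr⟩ : ∃ Pdr : ℝ, Pdr = 4 * kA₁ * (kR / (n : ℝ) ^ 2) * 373248 := ⟨_, rfl⟩
  obtain ⟨V₁, hV₁⟩ : ∃ V₁ : ℝ, V₁ = 4 * (cF / (n : ℝ) ^ 5) * (4 * kA * (cF / (n : ℝ) ^ 5) * (κ₂ * (n : ℝ) ^ 2)) * (κ₀ * (n : ℝ) ^ 4) := ⟨_, rfl⟩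
  obtain ⟨V₂, hV₂⟩ : ∃ V₂ : ℝ, V₂ = 4 * (4 * kA₁ * (kR / (n : ℝ) ^ 2) * 373248) * (cF / (n : ℝ) ^ 5) * (κ₂ * (n : ℝ) ^ 2) := ⟨_, rfl⟩
  obtain ⟨V₃, hV₃⟩ : ∃ V₃ : ℝ, V₃ = 4 * (cF / (n : ℝ) ^ 6) * (4 * kA * (cF / (n : ℝ) ^ 5) * (κ₂ * (n : ℝ) ^ 2)) * (κ₀ * (n : ℝ) ^ 4) := ⟨_, rfl⟩
  obtain ⟨V₄, hV₄⟩ : ∃ V₄ : ℝ, V₄ = 4 * (4 * kA * (kR / (n : ℝ) ^ 2) * 373248) * (cF / (n : ℝ) ^ 5) * (κ₁ * (n : ℝ) ^ 3) := ⟨_, rfl⟩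
  obtain ⟨V₅, hV₅⟩ : ∃ V₅ : ℝ, V₅ = 4 * (kR / (n : ℝ) ^ 2) * (4 * kA₁ * (cF / (n : ℝ) ^ 5) * (κ₃ * (n : ℝ) ^ 1)) * (κ₃' * (n : ℝ) ^ 1) := ⟨_, rfl⟩
  obtain ⟨V₇, hV₇⟩ : ∃ V₇ : ℝ, V₇ = 4 * (kR / (n : ℝ) ^ 2) * (4 * kA * (cF / (n : ℝ) ^ 5) * (κ₂ * (n : ℝ) ^ 2)) * (κ₃' * (n : ℝ) ^ 1) := ⟨_, rfl⟩
  obtain ⟨V₈, hV₈⟩ : ∃ V₈ : ℝ, V₈ = 4 * (cF / (n : ℝ) ^ 5) * (4 * kA * (cF / (n : ℝ) ^ 6) * (κ₂ * (n : ℝ) ^ 2)) * (κ₀ * (n : ℝ) ^ 4) := ⟨_, rfl⟩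
  have h0 : 0 ≤ Pp ∧ 0 ≤ Pdp ∧ 0 ≤ Pr ∧ 0 ≤ Pdr := by
    rw [hPp, hPdp, hPr, hPdr]; exact ⟨by positivity, by positivity, by positivity, by positivity⟩
  -- THE FOUR POINT VALUES
  have qPp : ∀ (u x : Site 4) (c : Fin 4), |applyK (Ga n a) (grad (fun q => Pgt n a u q () ())) x c| ≤ Pp * Real.exp (-(ε₀ / 2 / n) * supNorm (x - u)) := by
    intro u x c
    have h := abs_applyK_le_of_damped_flat (d := 4) (F := Fin 4) (by norm_num) (a := 2) (by norm_num) hkA hcF5 hεn u hA0 (hfn u 0).1 x c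
    rw [Fintype.card_fin] at h
    refine h.trans ((mul_le_mul_of_nonneg_left hK2 (by positivity)).trans (le_of_eq ?_))
    rw [hPp, erate]; push_cast; ring
  have qPdp : ∀ (u x : Site 4) (κ c : Fin 4), |applyK (Ga n a) (grad (fun q => Pgt n a u q () () - Pgt n a (u + unitVec κ) q () ())) x c|
      ≤ Pdp * Real.exp (-(ε₀ / 2 / n) * supNorm (x - u)) := by
    intro u x κ c
    have h := abs_applyK_le_of_damped_flat (d := 4) (F := Fin 4) (by norm_num) (a := 2) (by norm_num) hkA hcF6 hεn u hA0 (hfn u κ).2.1 x c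
    rw [Fintype.card_fin] at h
    refine h.trans ((mul_le_mul_of_nonneg_left hK2 (by positivity)).trans (le_of_eq ?_))
    rw [hPdp, erate]; push_cast; ring
  have qPr : ∀ (u x : Site 4) (c : Fin 4), |applyK (Ga n a) (grad (fun y => RG (Ggh n a) (Pgt n a) y u () ())) x c|
      ≤ Pr * Real.exp (-(ε₀ / 2 / n) * supNorm (x - u)) / nrm (x - u) := by
    intro u x c
    have h := abs_applyK_le_of_damped_profiles (d := 4) (F := Fin 4) (by norm_num) (a := 2) (b := 3) (by norm_num) (by norm_num) (by norm_num)
      hkA hkR2 hεn.le u hA0 (hfn u 0).2.2.1 x c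
    rw [Fintype.card_fin] at h
    have h' := h.trans (div_le_div_of_nonneg_right (mul_le_mul_of_nonneg_left (lrate (x - u)) (by positivity)) (pow_pos (nrm_pos _) _).le)
    rw [hPr]; norm_num at h' ⊢; exact h'
  have qPdr : ∀ (u x : Site 4) (κ c : Fin 4),
      |applyK (Ga n a) (grad (fun y => RG (Ggh n a) (Pgt n a) y (u + unitVec κ) () () - RG (Ggh n a) (Pgt n a) y u () ())) x c|
        ≤ Pdr * Real.exp (-(ε₀ / 2 / n) * supNorm (x - u)) / nrm (x - u) ^ 2 := by
    intro u x κ c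
    have h := abs_applyK_grad_le_of_damped_profiles hkA hkA' hkA₁ hkR2 hεn.le u hA0 hA0r hA1r (hfn u κ).2.2.2 x c
    have h' := h.trans (div_le_div_of_nonneg_right (mul_le_mul_of_nonneg_left (lrate (x - u)) (by positivity)) (pow_pos (nrm_pos _) _).le)
    rw [hPdr]; norm_num at h' ⊢; exact h'
  -- THE EIGHT PAIRING SUPS
  have qS₁ : ∀ (u q : Site 4), |pairing (grad (fun q' => Pgt n a u q' () ())) (applyK (Ga n a) (colGrad (Pgt n a) q))| ≤ V₁ := by
    intro u q
    rw [hcol q]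
    have h := abs_pairing_flat_flat_le u q hkA hcF5 hcF5 hεn hA0 (hfn u 0).1 (hfn q 0).1
    have l1 := lE (ε₀ / n / 2 / 2) (u - q) (by positivity)
    refine h.trans ((?_ : _ ≤ 4 * (cF / (n : ℝ) ^ 5) * (4 * kA * (cF / (n : ℝ) ^ 5) * (κ₂ * (n : ℝ) ^ 2)) * 1 * (κ₀ * (n : ℝ) ^ 4)).trans (le_of_eq ?_))
    · gcongr
    · rw [hV₁]; ring
  have qS₂ : ∀ (u p : Site 4) (κ : Fin 4),
      |pairing (applyK (Ga n a) (grad (fun y => RG (Ggh n a) (Pgt n a) y (u + unitVec κ) () () - RG (Ggh n a) (Pgt n a) y u () ())))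
        (rowGrad (Pgt n a) p)| ≤ V₂ := by
    intro u p κ
    rw [rowGrad_eq_grad, pairing_comm]
    have h := abs_pairing_flat_dip_le p u hkA hkA' hkA₁ hcF5 hkR2 hεn hA0 hA0r hA1r (hfn p 0).1 (hfn u κ).2.2.2
    have l1 := lE (ε₀ / n / 2) (u - p) (by positivity)
    refine h.trans ((?_ : _ ≤ 4 * (4 * kA₁ * (kR / (n : ℝ) ^ 2) * 373248) * (cF / (n : ℝ) ^ 5) * 1 * (κ₂ * (n : ℝ) ^ 2)).trans (le_of_eq ?_))
    · gcongr
    · rw [hV₂]; ring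
  have qS₃ : ∀ (u q : Site 4) (κ : Fin 4),
      |pairing (grad (fun q' => Pgt n a u q' () () - Pgt n a (u + unitVec κ) q' () ())) (applyK (Ga n a) (colGrad (Pgt n a) q))| ≤ V₃ := by
    intro u q κ
    rw [hcol q]
    have h := abs_pairing_flat_flat_le u q hkA hcF6 hcF5 hεn hA0 (hfn u κ).2.1 (hfn q 0).1
    have l1 := lE (ε₀ / n / 2 / 2) (u - q) (by positivity)
    refine h.trans ((?_ : _ ≤ 4 * (cF / (n : ℝ) ^ 6) * (4 * kA * (cF / (n : ℝ) ^ 5) * (κ₂ * (n : ℝ) ^ 2)) * 1 * (κ₀ * (n : ℝ) ^ 4)).trans (le_of_eq ?_))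
    · gcongr
    · rw [hV₃]; ring
  have qS₄ : ∀ (u p : Site 4), |pairing (applyK (Ga n a) (grad (fun y => RG (Ggh n a) (Pgt n a) y u () ()))) (rowGrad (Pgt n a) p)| ≤ V₄ := by
    intro u p
    rw [rowGrad_eq_grad, pairing_comm]
    have h := abs_pairing_flat_coul_le p u hkA hcF5 hkR2 hεn hA0 (hfn p 0).1 (hfn u 0).2.2.1
    have l1 := lE (ε₀ / n / 2) (u - p) (by positivity)
    refine h.trans ((?_ : _ ≤ 4 * (4 * kA * (kR / (n : ℝ) ^ 2) * 373248) * (cF / (n : ℝ) ^ 5) * 1 * (κ₁ * (n : ℝ) ^ 3)).trans (le_of_eq ?_))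
    · gcongr
    · rw [hV₄]; ring
  have qS₅ : ∀ (u q : Site 4) (κ : Fin 4),
      |pairing (grad (fun y => RG (Ggh n a) (Pgt n a) y (u + unitVec κ) () () - RG (Ggh n a) (Pgt n a) y u () ()))
        (applyK (Ga n a) (colGrad (Pgt n a) q))| ≤ V₅ := by
    intro u q κ
    rw [hcol q]
    have h := abs_pairing_dip_flat_le u q hkA hkA₁ hkR2 hcF5 hεn hA0 hA1l (hfn u κ).2.2.2 (hfn q 0).1
    have l1 := lE (ε₀ / n / 2 / 2) (u - q) (by positivity)
    refine h.trans ((?_ : _ ≤ 4 * (kR / (n : ℝ) ^ 2) * (4 * kA₁ * (cF / (n : ℝ) ^ 5) * (κ₃ * (n : ℝ) ^ 1)) * 1 * (κ₃' * (n : ℝ) ^ 1)).trans (le_of_eq ?_))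
    · gcongr
    · rw [hV₅]; ring
  have qS₆ : ∀ (u p : Site 4), |pairing (applyK (Ga n a) (grad (fun q' => Pgt n a u q' () ()))) (rowGrad (Pgt n a) p)| ≤ V₁ := by
    intro u p
    rw [rowGrad_eq_grad, pairing_comm]
    have h := abs_pairing_flat_flat_le p u hkA hcF5 hcF5 hεn hA0 (hfn p 0).1 (hfn u 0).1
    have l1 := lE (ε₀ / n / 2 / 2) (p - u) (by positivity)
    refine h.trans ((?_ : _ ≤ 4 * (cF / (n : ℝ) ^ 5) * (4 * kA * (cF / (n : ℝ) ^ 5) * (κ₂ * (n : ℝ) ^ 2)) * 1 * (κ₀ * (n : ℝ) ^ 4)).trans (le_of_eq ?_))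
    · gcongr
    · rw [hV₁]; ring
  have qS₇ : ∀ (u q : Site 4), |pairing (grad (fun y => RG (Ggh n a) (Pgt n a) y u () ())) (applyK (Ga n a) (colGrad (Pgt n a) q))| ≤ V₇ := by
    intro u q
    rw [hcol q]
    have h := abs_pairing_coul_flat_le u q hkA hkR2 hcF5 hεn hA0 (hfn u 0).2.2.1 (hfn q 0).1
    have l1 := lE (ε₀ / n / 2 / 2) (u - q) (by positivity)
    refine h.trans ((?_ : _ ≤ 4 * (kR / (n : ℝ) ^ 2) * (4 * kA * (cF / (n : ℝ) ^ 5) * (κ₂ * (n : ℝ) ^ 2)) * 1 * (κ₃' * (n : ℝ) ^ 1)).trans (le_of_eq ?_))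
    · gcongr
    · rw [hV₇]; ring
  have qS₈ : ∀ (u p : Site 4) (κ : Fin 4),
      |pairing (applyK (Ga n a) (grad (fun q' => Pgt n a u q' () () - Pgt n a (u + unitVec κ) q' () ()))) (rowGrad (Pgt n a) p)| ≤ V₈ := by
    intro u p κ
    rw [rowGrad_eq_grad, pairing_comm]
    have h := abs_pairing_flat_flat_le p u hkA hcF5 hcF6 hεn hA0 (hfn p 0).1 (hfn u κ).2.1
    have l1 := lE (ε₀ / n / 2 / 2) (p - u) (by positivity)
    refine h.trans ((?_ : _ ≤ 4 * (cF / (n : ℝ) ^ 5) * (4 * kA * (cF / (n : ℝ) ^ 6) * (κ₂ * (n : ℝ) ^ 2)) * 1 * (κ₀ * (n : ℝ) ^ 4)).trans (le_of_eq ?_))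
    · gcongr
    · rw [hV₈]; ring
  -- PART 1 and the n-power bookkeeping
  have h := abs_dipProj_word_le ha hA h0 qPp qPdp qPr qPdr qS₁ qS₂ qS₃ qS₄ qS₅ qS₆ qS₇ qS₈ κ κ' u v
  clear qPp qPdp qPr qPdr qS₁ qS₂ qS₃ qS₄ qS₅ qS₆ qS₇ qS₈ hK0 hK1 hK2 hK3 hK3' hfn hA0 hA0r hA1r hA1l hleg hfun lE lrate erate hcol
  have e0 : Pp * V₂ + Pdp * V₄ + V₅ * Pp + V₇ * Pdp = T₀ / (n : ℝ) ^ 8 := by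
    rw [hPp, hPdp, hV₂, hV₄, hV₅, hV₇, hT₀]; field_simp
  have e1 : V₃ * Pr + Pr * V₈ = T₁ / (n : ℝ) ^ 7 := by
    rw [hPr, hV₃, hV₈, hT₁]; field_simp
  have e2 : V₁ * Pdr + Pdr * V₁ = T₂ / (n : ℝ) ^ 6 := by
    rw [hPdr, hV₁, hT₂]; field_simp
  rw [e0, e1, e2] at h
  exact h

/-! ## §2 A cell whose table is pointwise in the three shapes -/

/-- [folklore] **A CELL IN THE THREE SHAPES**: if `|biBubbleTable (Ga)(Ga) S T μ ν (b+w) b| ≤ Z₀·e^{−(η∕n)‖w‖} + Z₁·e∕nrm(w) + Z₂·e∕nrm(w)²` at every base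
site `b` and displacement `w` (`η > 0`, `Z's ≥ 0`, `n ≥ 1`) then `|cellSum n a S T μ ν| ≤ Z₀·S₀·n⁶ + Z₁·S₁·n⁵ + Z₂·S₂·n⁴` with the (1.22) constants of
`NeedleDipDipRow.abs_fullSum_threeShapes_le` (the base average `Σ_b n⁻⁴` is convex: `NeedleProjProjRow.sum_resSite_avg_le`). -/
theorem abs_cellSum_le_of_threeShapes {n : ℕ} [NeZero n] (hn : 1 ≤ n) {a η Z₀ Z₁ Z₂ : ℝ} (hη : 0 < η) (hZ₀ : 0 ≤ Z₀) (hZ₁ : 0 ≤ Z₁) (hZ₂ : 0 ≤ Z₂)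
    {S T : StencilR} (μ ν : Fin 4)
    (hf : ∀ b w : Pt, |biBubbleTable (Ga n a) (Ga n a) S T μ ν (b + w) b| ≤ Z₀ * Real.exp (-(η / n) * supNorm (d := 4) w)
      + Z₁ * Real.exp (-(η / n) * supNorm (d := 4) w) / nrm (d := 4) w + Z₂ * Real.exp (-(η / n) * supNorm (d := 4) w) / nrm (d := 4) w ^ 2) :
    |cellSum n a S T μ ν| ≤
      Z₀ * (2 * (2 : ℕ).factorial * (2 / η) ^ 2 * (1 + 2 * (4 : ℕ) * 3 ^ (4 - 1) * ((4 - 1 - 0).factorial * (4 / η) ^ (4 - 1 - 0) * (1 + 4 / η)))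
          * (n : ℝ) ^ (4 - 0 + 2))
      + Z₁ * (2 * (2 : ℕ).factorial * (2 / η) ^ 2 * (1 + 2 * (4 : ℕ) * 3 ^ (4 - 1) * ((4 - 1 - 1).factorial * (4 / η) ^ (4 - 1 - 1) * (1 + 4 / η)))
          * (n : ℝ) ^ (4 - 1 + 2))
      + Z₂ * (2 * (2 : ℕ).factorial * (2 / η) ^ 2 * (1 + 2 * (4 : ℕ) * 3 ^ (4 - 1) * ((4 - 1 - 2).factorial * (4 / η) ^ (4 - 1 - 2) * (1 + 4 / η)))
          * (n : ℝ) ^ (4 - 2 + 2)) := by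
  have hsite := fun b : Pt => abs_fullSum_threeShapes_le hn hη hZ₀ hZ₁ hZ₂ (hf b) μ ν
  have hK : 0 ≤ Z₀ * (2 * (2 : ℕ).factorial * (2 / η) ^ 2 * (1 + 2 * (4 : ℕ) * 3 ^ (4 - 1) * ((4 - 1 - 0).factorial * (4 / η) ^ (4 - 1 - 0) * (1 + 4 / η)))
          * (n : ℝ) ^ (4 - 0 + 2))
      + Z₁ * (2 * (2 : ℕ).factorial * (2 / η) ^ 2 * (1 + 2 * (4 : ℕ) * 3 ^ (4 - 1) * ((4 - 1 - 1).factorial * (4 / η) ^ (4 - 1 - 1) * (1 + 4 / η)))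
          * (n : ℝ) ^ (4 - 1 + 2))
      + Z₂ * (2 * (2 : ℕ).factorial * (2 / η) ^ 2 * (1 + 2 * (4 : ℕ) * 3 ^ (4 - 1) * ((4 - 1 - 2).factorial * (4 / η) ^ (4 - 1 - 2) * (1 + 4 / η)))
          * (n : ℝ) ^ (4 - 2 + 2)) := by positivity
  rw [cellSum_def]
  refine (Finset.abs_sum_le_sum_abs _ _).trans ((Finset.sum_le_sum fun b _ => ?_).trans (sum_resSite_avg_le hK))
  rw [abs_mul, abs_of_nonneg (by positivity : (0 : ℝ) ≤ ((n : ℝ) ^ 4)⁻¹)]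
  exact mul_le_mul_of_nonneg_left (hsite b) (by positivity)

/-! ## §3 The two cells -/

/-- [folklore] **«GN-33 ∕ KP»: THE `dipPiece ⊗ projPiece` CELL OF T₃ WITH ITS WEIGHT IS n-UNIFORM**, modulo [B5, Prop. 1.2] ∧ [B5, (1.126)–(1.127)] BY
NAME and the ray letter `|cK n| ≤ cgh·n²` (P13: the constant is `cgh·(T₀S₀ + T₁S₁ + T₂S₂)`): one `Cdp ≥ 0` with
`|cK n·cellSum n a (dipPiece n a) (projPiece n a) μ ν| ≤ Cdp` for every `n ≥ 2` — hypothesis `hdp` of `GluonNeedleGlue.h₃_of_cells`.  No pairing letter is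
displayed: the word has no Coulomb × Coulomb type. -/
theorem exists_dipProj_row_le {a : ℝ} (ha : 0 < a) (h12 : B5.Prop12Printed (fam nOf hn1 MOf a ha)) (h126 : B5.Kernel126_127Printed (kfam nOf MOf))
    {cK : ℕ → ℝ} {cgh : ℝ} (hcK : ∀ n : ℕ, |cK n| ≤ cgh * (n : ℝ) ^ 2) (μ ν : Fin 4) :
    ∃ Cdp : ℝ, 0 ≤ Cdp ∧ ∀ n : ℕ, 2 ≤ n → ∀ [NeZero n], |cK n * cellSum n a (dipPiece n a) (projPiece n a) μ ν| ≤ Cdp := by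
  obtain ⟨η, T₀, T₁, T₂, hη, hT₀, hT₁, hT₂, hpt⟩ := exists_dipProj_word_threeShapes ha h12 h126
  obtain ⟨s₀, hs₀⟩ : ∃ s₀ : ℝ, s₀ = (2 * (Nat.factorial 2 : ℝ) * (2 / η) ^ 2 * (1 + 2 * ((4 : ℕ) : ℝ) * 3 ^ (4 - 1) *
    ((Nat.factorial (4 - 1 - 0) : ℝ) * (4 / η) ^ (4 - 1 - 0) * (1 + 4 / η)))) := ⟨_, rfl⟩
  obtain ⟨s₁, hs₁⟩ : ∃ s₁ : ℝ, s₁ = (2 * (Nat.factorial 2 : ℝ) * (2 / η) ^ 2 * (1 + 2 * ((4 : ℕ) : ℝ) * 3 ^ (4 - 1) *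
    ((Nat.factorial (4 - 1 - 1) : ℝ) * (4 / η) ^ (4 - 1 - 1) * (1 + 4 / η)))) := ⟨_, rfl⟩
  obtain ⟨s₂, hs₂⟩ : ∃ s₂ : ℝ, s₂ = (2 * (Nat.factorial 2 : ℝ) * (2 / η) ^ 2 * (1 + 2 * ((4 : ℕ) : ℝ) * 3 ^ (4 - 1) *
    ((Nat.factorial (4 - 1 - 2) : ℝ) * (4 / η) ^ (4 - 1 - 2) * (1 + 4 / η)))) := ⟨_, rfl⟩
  obtain ⟨hs₀0, hs₁0, hs₂0⟩ : 0 ≤ s₀ ∧ 0 ≤ s₁ ∧ 0 ≤ s₂ := ⟨by rw [hs₀]; positivity, by rw [hs₁]; positivity, by rw [hs₂]; positivity⟩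
  have hcgh : 0 ≤ cgh := by have h := hcK 1; norm_num at h; exact (abs_nonneg _).trans h
  refine ⟨cgh * (T₀ * s₀ + T₁ * s₁ + T₂ * s₂), by positivity, fun n hn2 _ => ?_⟩
  have hn1 : 1 ≤ n := le_trans (by norm_num) hn2
  have hn0 : (n : ℝ) ≠ 0 := by exact_mod_cast NeZero.ne n
  have hf : ∀ b w : Pt, |biBubbleTable (Ga n a) (Ga n a) (dipPiece n a) (projPiece n a) μ ν (b + w) b|
      ≤ T₀ / (n : ℝ) ^ 8 * Real.exp (-(η / n) * supNorm (d := 4) w) + T₁ / (n : ℝ) ^ 7 * Real.exp (-(η / n) * supNorm (d := 4) w) / nrm (d := 4) w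
        + T₂ / (n : ℝ) ^ 6 * Real.exp (-(η / n) * supNorm (d := 4) w) / nrm (d := 4) w ^ 2 := by
    intro b w
    have h := hpt n μ ν (b + w) b
    rw [add_sub_cancel_left] at h
    rw [biBubbleTable_apply, ← bubble_eq_biBubble, abs_mul, abs_neg, abs_of_pos (by norm_num : (0 : ℝ) < 1 / 2)]
    have hB := abs_nonneg (bubble (Ga n a) (dipPiece n a μ (b + w)) (projPiece n a ν b))
    linarith only [h, hB]
  have hcell := abs_cellSum_le_of_threeShapes hn1 hη (by positivity) (by positivity) (by positivity) μ ν hf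
  rw [abs_mul]
  refine (mul_le_mul (hcK n) hcell (abs_nonneg _) (by positivity)).trans (le_of_eq ?_)
  rw [hs₀, hs₁, hs₂]
  push_cast
  field_simp

/-- [folklore] **«GN-33 ∕ PK»: THE `projPiece ⊗ dipPiece` CELL OF T₃ WITH ITS WEIGHT IS n-UNIFORM**, modulo [B5, Prop. 1.2] ∧ [B5, (1.126)–(1.127)] BY
NAME and the ray letter `|cK n| ≤ cgh·n²`: one `Cpd ≥ 0` with `|cK n·cellSum n a (projPiece n a) (dipPiece n a) μ ν| ≤ Cpd` for every `n ≥ 2` —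
hypothesis `hpd` of `GluonNeedleGlue.h₃_of_cells` (the `dip ⊗ proj` word read at `(ν, μ, b, b+w)` by `biBubbleTable_transpose`; §1's bound is even in
`u − v`). -/
theorem exists_projDip_row_le {a : ℝ} (ha : 0 < a) (h12 : B5.Prop12Printed (fam nOf hn1 MOf a ha)) (h126 : B5.Kernel126_127Printed (kfam nOf MOf))
    {cK : ℕ → ℝ} {cgh : ℝ} (hcK : ∀ n : ℕ, |cK n| ≤ cgh * (n : ℝ) ^ 2) (μ ν : Fin 4) :
    ∃ Cpd : ℝ, 0 ≤ Cpd ∧ ∀ n : ℕ, 2 ≤ n → ∀ [NeZero n], |cK n * cellSum n a (projPiece n a) (dipPiece n a) μ ν| ≤ Cpd := by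
  obtain ⟨η, T₀, T₁, T₂, hη, hT₀, hT₁, hT₂, hpt⟩ := exists_dipProj_word_threeShapes ha h12 h126
  obtain ⟨s₀, hs₀⟩ : ∃ s₀ : ℝ, s₀ = (2 * (Nat.factorial 2 : ℝ) * (2 / η) ^ 2 * (1 + 2 * ((4 : ℕ) : ℝ) * 3 ^ (4 - 1) *
    ((Nat.factorial (4 - 1 - 0) : ℝ) * (4 / η) ^ (4 - 1 - 0) * (1 + 4 / η)))) := ⟨_, rfl⟩
  obtain ⟨s₁, hs₁⟩ : ∃ s₁ : ℝ, s₁ = (2 * (Nat.factorial 2 : ℝ) * (2 / η) ^ 2 * (1 + 2 * ((4 : ℕ) : ℝ) * 3 ^ (4 - 1) *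
    ((Nat.factorial (4 - 1 - 1) : ℝ) * (4 / η) ^ (4 - 1 - 1) * (1 + 4 / η)))) := ⟨_, rfl⟩
  obtain ⟨s₂, hs₂⟩ : ∃ s₂ : ℝ, s₂ = (2 * (Nat.factorial 2 : ℝ) * (2 / η) ^ 2 * (1 + 2 * ((4 : ℕ) : ℝ) * 3 ^ (4 - 1) *
    ((Nat.factorial (4 - 1 - 2) : ℝ) * (4 / η) ^ (4 - 1 - 2) * (1 + 4 / η)))) := ⟨_, rfl⟩
  obtain ⟨hs₀0, hs₁0, hs₂0⟩ : 0 ≤ s₀ ∧ 0 ≤ s₁ ∧ 0 ≤ s₂ := ⟨by rw [hs₀]; positivity, by rw [hs₁]; positivity, by rw [hs₂]; positivity⟩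
  have hcgh : 0 ≤ cgh := by have h := hcK 1; norm_num at h; exact (abs_nonneg _).trans h
  refine ⟨cgh * (T₀ * s₀ + T₁ * s₁ + T₂ * s₂), by positivity, fun n hn2 _ => ?_⟩
  have hn1 : 1 ≤ n := le_trans (by norm_num) hn2
  have hn0 : (n : ℝ) ≠ 0 := by exact_mod_cast NeZero.ne n
  have hA : Spr (Ga n a) := spr_Ga_of_prop12 (a := a) (ha := ha) h12 h126 n
  obtain ⟨Cp, δp, hδp, hSp⟩ := exists_biLoc_projPiece n a ha
  obtain ⟨Cd, δd, hδd, hSd⟩ := exists_biLoc_dipPiece n a ha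
  have hf : ∀ b w : Pt, |biBubbleTable (Ga n a) (Ga n a) (projPiece n a) (dipPiece n a) μ ν (b + w) b|
      ≤ T₀ / (n : ℝ) ^ 8 * Real.exp (-(η / n) * supNorm (d := 4) w) + T₁ / (n : ℝ) ^ 7 * Real.exp (-(η / n) * supNorm (d := 4) w) / nrm (d := 4) w
        + T₂ / (n : ℝ) ^ 6 * Real.exp (-(η / n) * supNorm (d := 4) w) / nrm (d := 4) w ^ 2 := by
    intro b w
    have h := hpt n ν μ b (b + w)
    rw [sub_add_cancel_left, supNorm_neg, nrm_neg] at h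
    rw [biBubbleTable_transpose (A := Ga n a) (B := Ga n a) hA hA hSp hδp hSd hδd μ ν (b + w) b, biBubbleTable_apply, ← bubble_eq_biBubble, abs_mul, abs_neg,
      abs_of_pos (by norm_num : (0 : ℝ) < 1 / 2)]
    have hB := abs_nonneg (bubble (Ga n a) (dipPiece n a ν b) (projPiece n a μ (b + w)))
    linarith only [h, hB]
  have hcell := abs_cellSum_le_of_threeShapes hn1 hη (by positivity) (by positivity) (by positivity) μ ν hf
  rw [abs_mul]
  refine (mul_le_mul (hcK n) hcell (abs_nonneg _) (by positivity)).trans (le_of_eq ?_)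
  rw [hs₀, hs₁, hs₂]
  push_cast
  field_simp

end Summit.QuantumFields.BalabanUV.Beta.D1BFx.NeedleDipProjRow

end
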